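import Summits.CriticalPhenomena.SAWScalingLimit.Theorems.SAWMassiveIsingTiltLatticeUniversalityKernelPinned
import Summits.CriticalPhenomena.SAWScalingLimit.Theorems.SAWMassiveIsingTiltHexEndpointApproxExists
import Literature.Probability.RandomPlanarGeometry.SLEUniquenessInLaw
import HarnessLib

/-!
# Crux `LatticeUniversality` (stmt-CriticalPhenomena-0807), line `registered` (birth v4.2) — the kernel SPLIT:
# VCR = (E*) hexagonal endpoint robustness ∧ (L*) one good vertex approximation per domain

Line lead c5 (prover-line-stmt-CriticalPhenomena-0807-c5-0, 2026-08-17), `--supports stmt-CriticalPhenomena-0807`.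

The kernel of the line, VCR (`stub_hexVertexRobust` of skeleton v4.1: for every chordal `P` with `RL(π/3) P`, (HexVL)(P) —
the σ-pushed VERTEX-convention critical hexagonal laws of `D` converge to `P (σD)` for EVERY hexagonal endpoint
approximation), is EQUIVALENT to the crux granted route SAWTrackTransport's three items
(`latticeUniversality_iff_hexVertexRobust`, p165464). This file cuts it into two statements of different standing:

* **(E*) `HexEndpointRobust`** — hexagonal only, vertex convention, no limit object, no Yang–Baxter vocabulary: for every
  Dobrushin domain `D` and ANY TWO hexagonal endpoint approximations `(a, b)`, `(a', b')` of `D`, the critical hexagonal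
  chordal laws of `D` between `a δ, b δ` and between `a' δ, b' δ` merge on bounded `1`-Lipschitz test functions.
  It is a COROLLARY OF THE CRUX ALONE (`hexEndpointRobust_of_latticeUniversality`, from p165464's
  `hexEndpointMerging_of_latticeUniversality`, which gives it even on all of `C_b`): every proof of stmt-0807, on every
  line, proves (E*) — a no-regret statement.
* **(L*) `HexLayerRobust`** (∃-form) — for every chordal `P` with `RL(π/3) P` and every Dobrushin domain `D`, SOME
  hexagonal endpoint approximation of `D` has its σ-pushed vertex-convention laws converging to `P (σD)`. Its prover
  chooses the approximation — e.g. the boundary-triangle tips of the exact `π/3` dictionary, for which (L*) is the pure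
  boundary-MONOLAYER statement (inner-cell versus vertex discretisation of one domain from the same endpoints,
  `K2-ANALYSIS-c2.md` §3 (L)); this is the part of the kernel that is an artefact of the Glazman–Manolescu relay.

Proved here (sorry-free, standard axioms):
* `hexVertexRobust_of_endpoint_layer` — **(E*) → (L*) → VCR** (for a given approximation, (E*) merges its laws on
  bounded Lipschitz functions with those of the good approximation of (L*), which converge; the convergent upgrade
  `tendsto_integral_sub_of_tendstoLaw`, p153935, finishes — the quarter turn is an isometry, so `f ∘ σ` stays
  `1`-Lipschitz);
* `hexLayerRobust_of_hexVertexRobust` — VCR → (L*) (hexagonal endpoint approximations exist, item 9864);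
* `hexEndpointRobust_of_latticeUniversality` — LatticeUniversality → (E*); `hexEndpointRobust_of_hexConjecture` — (A) → (E*)
  (so (E*) is implied by EACH of the cruxes stmt-0807 and stmt-0808 separately);
* `latticeUniversality_of_endpoint_layer` — **(E*) → (L*) → RobustSquareLimit → AngleUniversality → YBtoUniform →
  LatticeUniversality** (the v4.2 composition of the line; registered arrow form
  `latticeUniversality_of_endpointLayerRobustSquare`);
* `latticeUniversality_iff_endpoint_layer` — granted the three transport items, **LatticeUniversality ↔ (E*) ∧ (L*)**.

So, granted stmt-16995 (ii), stmt-16963, stmt-16966:  LatticeUniversality ↔ VCR ↔ K2∀ ↔ (E*) ∧ (L*), with (E*) necessary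
for the crux unconditionally. [folklore]
-/

noncomputable section

namespace Summit.CriticalPhenomena.SAWScalingLimit.Cruxes.LatticeUniversality.Birth

open MeasureTheory Filter Topology Set
open scoped NNReal ENNReal BoundedContinuousFunction
open Complex (I I_ne_zero)
open Literature.Probability.RandomPlanarGeometry
open Literature.Probability.RandomPlanarGeometry.SAW
open Literature.Probability.RandomPlanarGeometry.SAW.YangBaxter
open Literature.Probability.LatticeModels (Site HexVertex hexGraph hexCenter)
open Summit.CriticalPhenomena.SAWScalingLimit.Theses
open Summit.CriticalPhenomena.SAWScalingLimit.Cruxes.HexTransfer.YbRelay (third IsBdryEdge bdryVertex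
  faceDomain gmSimilarity)
open Summit.CriticalPhenomena.SAWScalingLimit.Theorems.ObservableToSLE.Negative
  (eventually_isProbabilityMeasure_hexSAWLaw)

/-! ### The quarter turn on curve classes -/

/-- The quarter turn `σ z = i z` acts on curve classes as a `1`-Lipschitz map (an isometry of the plane, pushed to
the reparametrisation distance). [folklore] -/
theorem lipschitzWith_one_map_quarterTurn :
    LipschitzWith 1 (CurveClass.map (similarity I I_ne_zero 0 : C(ℂ, ℂ)) :
      CurveClass ℂ → CurveClass ℂ) := by
  have h := CurveClass.lipschitzWith_map (lipschitzWith_similarity I I_ne_zero 0)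
  simpa using h

/-! ### (E*) ∧ (L*) → VCR -/

/-- **(E*) → (L*) → VCR.** Let `P` be chordal with `RL(π/3) P`, `D` a Dobrushin domain and `(a, b)` any hexagonal
endpoint approximation of `D`. By (L*) some approximation `(a₀, b₀)` of `D` has σ-pushed laws converging to `P (σD)`;
by (E*) (tested on `φ ∘ σ`, `1`-Lipschitz since `σ` is an isometry) the σ-pushed laws along `(a, b)` and along
`(a₀, b₀)` merge on bounded `1`-Lipschitz functions; the laws along `(a, b)` are probability measures for small `δ`
(`eventually_isProbabilityMeasure_hexSAWLaw`), so the convergent upgrade `tendsto_integral_sub_of_tendstoLaw` gives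
merging on `C_b`, i.e. convergence along `(a, b)` too. [folklore] -/
theorem hexVertexRobust_of_endpoint_layer
    (hE : ∀ (D : DobrushinDomain) (a b a' b' : ℝ → HexVertex), SAW.IsEmbEndpointApprox hexGraph hexCenter D a b → SAW.IsEmbEndpointApprox hexGraph hexCenter D a' b' → ∀ f : BoundedContinuousFunction (CurveClass ℂ) ℝ, LipschitzWith 1 f → Tendsto (fun δ : ℝ => (∫ γ, f γ.curve ∂(SAW.hexSAWLaw D.carrier δ (a δ) (b δ))) - ∫ γ, f γ.curve ∂(SAW.hexSAWLaw D.carrier δ (a' δ) (b' δ))) (𝓝[>] (0 : ℝ)) (𝓝 0))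
    (hL : ∀ P : ChordalFamily, P.IsChordal → (∀ (D : DobrushinDomain) (u : ℝ → ℂ) (a b : ℝ → MidEdge), (∀ᶠ δ in 𝓝[>] (0 : ℝ), ‖u δ‖ ≤ δ) → (∀ᶠ δ in 𝓝[>] (0 : ℝ), Nonempty (YangBaxterSAW (fun (_ : ℤ) => Real.pi / 3) ((D.map (similarity 1 one_ne_zero (u δ))).carrier) δ (a δ) (b δ))) → Tendsto (fun δ : ℝ => (δ : ℂ) * planeMidpoint (fun (_ : ℤ) => Real.pi / 3) (a δ)) (𝓝[>] (0 : ℝ)) (𝓝 (D.pt 0)) → Tendsto (fun δ : ℝ => (δ : ℂ) * planeMidpoint (fun (_ : ℤ) => Real.pi / 3) (b δ)) (𝓝[>] (0 : ℝ)) (𝓝 (D.pt 1)) → TendstoLaw (fun δ (γ : YangBaxterSAW (fun (_ : ℤ) => Real.pi / 3) ((D.map (similarity 1 one_ne_zero (u δ))).carrier) δ (a δ) (b δ)) => γ.curve (fun (_ : ℤ) => Real.pi / 3) δ) (fun δ => ybLaw (fun (_ : ℤ) => Real.pi / 3) ((D.map (similarity 1 one_ne_zero (u δ))).carrier) δ 1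 (a δ) (b δ)) id (P D)) → ∀ D : DobrushinDomain, ∃ a b : ℝ → HexVertex, SAW.IsEmbEndpointApprox hexGraph hexCenter D a b ∧ TendstoLaw (fun δ (γ : SAW.HexDomainSAW D.carrier δ (a δ) (b δ)) => CurveClass.map (similarity I I_ne_zero 0 : C(ℂ, ℂ)) γ.curve) (fun δ => SAW.hexSAWLaw D.carrier δ (a δ) (b δ)) id (P (D.map (similarity I I_ne_zero 0)))) :
    ∀ P : ChordalFamily, P.IsChordal → (∀ (D : DobrushinDomain) (u : ℝ → ℂ) (a b : ℝ → MidEdge), (∀ᶠ δ in 𝓝[>] (0 : ℝ), ‖u δ‖ ≤ δ) → (∀ᶠ δ in 𝓝[>] (0 : ℝ), Nonempty (YangBaxterSAW (fun (_ : ℤ) => Real.pi / 3) ((D.map (similarity 1 one_ne_zero (u δ))).carrier) δ (a δ) (b δ))) → Tendsto (fun δ : ℝ => (δ : ℂ) * planeMidpoint (fun (_ : ℤ) => Real.pi / 3) (a δ)) (𝓝[>] (0 : ℝ)) (𝓝 (D.pt 0)) → Tendsto (fun δ : ℝ => (δ : ℂ) * planeMidpoint (fun (_ : ℤ) => Real.pi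 / 3) (b δ)) (𝓝[>] (0 : ℝ)) (𝓝 (D.pt 1)) → TendstoLaw (fun δ (γ : YangBaxterSAW (fun (_ : ℤ) => Real.pi / 3) ((D.map (similarity 1 one_ne_zero (u δ))).carrier) δ (a δ) (b δ)) => γ.curve (fun (_ : ℤ) => Real.pi / 3) δ) (fun δ => ybLaw (fun (_ : ℤ) => Real.pi / 3) ((D.map (similarity 1 one_ne_zero (u δ))).carrier) δ 1 (a δ) (b δ)) id (P D)) → ∀ (D : DobrushinDomain) (a b : ℝ → HexVertex), SAW.IsEmbEndpointApprox hexGraph hexCenter D a b → TendstoLaw (fun δ (γ : SAW.HexDomainSAW D.carrier δ (a δ) (b δ)) => CurveClass.map (similarity I I_ne_zero 0 : C(ℂ, ℂ)) γ.curve) (fun δ => SAW.hexSAWLaw D.carrier δ (a δ) (b δ)) id (P (D.map (similarity I I_ne_zero 0))) := by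
  intro P hPch hRL3 D a b hab g
  haveI : IsProbabilityMeasure (P (D.map (similarity I I_ne_zero 0))) := (hPch _).1
  obtain ⟨a₀, b₀, hab₀, hconv₀⟩ := hL P hPch hRL3 D
  have hBL : ∀ φ : BoundedContinuousFunction (CurveClass ℂ) ℝ, LipschitzWith 1 φ →
      Tendsto (fun δ : ℝ =>
          (∫ γ, φ (CurveClass.map (similarity I I_ne_zero 0 : C(ℂ, ℂ)) γ.curve)
              ∂(SAW.hexSAWLaw D.carrier δ (a δ) (b δ))) -
            ∫ γ, φ (CurveClass.map (similarity I I_ne_zero 0 : C(ℂ, ℂ)) γ.curve)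
              ∂(SAW.hexSAWLaw D.carrier δ (a₀ δ) (b₀ δ)))
        (𝓝[>] (0 : ℝ)) (𝓝 0) := by
    intro φ hφ
    set ψ : BoundedContinuousFunction (CurveClass ℂ) ℝ := φ.compContinuous
      ⟨CurveClass.map (similarity I I_ne_zero 0 : C(ℂ, ℂ)), lipschitzWith_one_map_quarterTurn.continuous⟩
      with hψ_def
    have hψ : LipschitzWith 1 ψ := by
      have h := hφ.comp lipschitzWith_one_map_quarterTurn
      simpa [hψ_def] using h
    have h := hE D a b a₀ b₀ hab hab₀ ψ hψ
    simpa [hψ_def, BoundedContinuousFunction.compContinuous_apply] using h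
  have hXY := tendsto_integral_sub_of_tendstoLaw (eventually_isProbabilityMeasure_hexSAWLaw hab)
    (fun δ => SAW.EmbDomainSAW.measurable_of_top _) aemeasurable_id hconv₀ hBL g
  have h := hXY.add (hconv₀ g)
  rw [zero_add] at h
  exact h.congr fun δ => sub_add_cancel _ _

/-- **VCR → (L*)**: hexagonal endpoint approximations exist in every Dobrushin domain
(`HexEndpointApprox.exists_isEmbEndpointApprox`, item 9864), and VCR serves each of them. [folklore] -/
theorem hexLayerRobust_of_hexVertexRobust
    (h : ∀ P : ChordalFamily, P.IsChordal → (∀ (D : DobrushinDomain) (u : ℝ → ℂ) (a b : ℝ → MidEdge), (∀ᶠ δ in 𝓝[>] (0 : ℝ), ‖u δ‖ ≤ δ) → (∀ᶠ δ in 𝓝[>] (0 : ℝ), Nonempty (YangBaxterSAW (fun (_ : ℤ) => Real.pi / 3) ((D.map (similarity 1 one_ne_zero (u δ))).carrier) δ (a δ) (b δ))) → Tendsto (fun δ : ℝ => (δ : ℂ) * planeMidpoint (fun (_ : ℤ) => Real.pi / 3) (a δ)) (𝓝[>] (0 : ℝ)) (𝓝 (D.pt 0)) → Tendsto (fun δ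 : ℝ => (δ : ℂ) * planeMidpoint (fun (_ : ℤ) => Real.pi / 3) (b δ)) (𝓝[>] (0 : ℝ)) (𝓝 (D.pt 1)) → TendstoLaw (fun δ (γ : YangBaxterSAW (fun (_ : ℤ) => Real.pi / 3) ((D.map (similarity 1 one_ne_zero (u δ))).carrier) δ (a δ) (b δ)) => γ.curve (fun (_ : ℤ) => Real.pi / 3) δ) (fun δ => ybLaw (fun (_ : ℤ) => Real.pi / 3) ((D.map (similarity 1 one_ne_zero (u δ))).carrier) δ 1 (a δ) (b δ)) id (P D)) → ∀ (D : DobrushinDomain) (a b : ℝ → HexVertex), SAW.IsEmbEndpointApprox hexGraph hexCenter D a b → TendstoLaw (fun δ (γ : SAW.HexDomainSAW D.carrier δ (a δ) (b δ)) => CurveClass.map (similarity I I_ne_zero 0 : C(ℂ, ℂ)) γ.curve) (fun δ => SAW.hexSAWLaw D.carrier δ (a δ) (b δ)) id (P (D.map (similarity I I_ne_zero 0)))) :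
    ∀ P : ChordalFamily, P.IsChordal → (∀ (D : DobrushinDomain) (u : ℝ → ℂ) (a b : ℝ → MidEdge), (∀ᶠ δ in 𝓝[>] (0 : ℝ), ‖u δ‖ ≤ δ) → (∀ᶠ δ in 𝓝[>] (0 : ℝ), Nonempty (YangBaxterSAW (fun (_ : ℤ) => Real.pi / 3) ((D.map (similarity 1 one_ne_zero (u δ))).carrier) δ (a δ) (b δ))) → Tendsto (fun δ : ℝ => (δ : ℂ) * planeMidpoint (fun (_ : ℤ) => Real.pi / 3) (a δ)) (𝓝[>] (0 : ℝ)) (𝓝 (D.pt 0)) → Tendsto (fun δ : ℝ => (δ : ℂ) * planeMidpoint (fun (_ : ℤ) => Real.pi / 3) (b δ)) (𝓝[>] (0 : ℝ)) (𝓝 (D.pt 1)) → TendstoLaw (fun δ (γ : YangBaxterSAW (fun (_ : ℤ) => Real.pi / 3) ((D.map (similarity 1 one_ne_zero (u δ))).carrier) δ (a δ) (b δ)) => γ.curve (fun (_ : ℤ) => Real.pi / 3) δ) (fun δ => ybLaw (fun (_ : ℤ) => Real.pi / 3) ((D.map (similarity 1 one_ne_zero (u δ))).carrier) δ 1 (a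 δ) (b δ)) id (P D)) → ∀ D : DobrushinDomain, ∃ a b : ℝ → HexVertex, SAW.IsEmbEndpointApprox hexGraph hexCenter D a b ∧ TendstoLaw (fun δ (γ : SAW.HexDomainSAW D.carrier δ (a δ) (b δ)) => CurveClass.map (similarity I I_ne_zero 0 : C(ℂ, ℂ)) γ.curve) (fun δ => SAW.hexSAWLaw D.carrier δ (a δ) (b δ)) id (P (D.map (similarity I I_ne_zero 0))) := by
  intro P hPch hRL3 D
  obtain ⟨a, b, hab⟩ := Theorems.HexEndpointApprox.exists_isEmbEndpointApprox D
  exact ⟨a, b, hab, h P hPch hRL3 D a b hab⟩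

/-! ### (E*) is a corollary of the crux -/

/-- **LatticeUniversality → (E*)**: endpoint robustness of the critical hexagonal chordal law (vertex convention,
bounded-Lipschitz — indeed all bounded continuous — test functions) follows from the crux alone
(`hexEndpointMerging_of_latticeUniversality`, p165464: compare both approximations with one `δℤ²` approximation).
Every proof of stmt-0807 proves (E*). [folklore] -/
theorem hexEndpointRobust_of_latticeUniversality (hU : SAWMassiveIsingTilt.LatticeUniversality) :
    ∀ (D : DobrushinDomain) (a b a' b' : ℝ → HexVertex), SAW.IsEmbEndpointApprox hexGraph hexCenter D a b → SAW.IsEmbEndpointApprox hexGraph hexCenter D a' b' → ∀ f : BoundedContinuousFunction (CurveClass ℂ) ℝ, LipschitzWith 1 f → Tendsto (fun δ : ℝ => (∫ γ, f γ.curve ∂(SAW.hexSAWLaw D.carrier δ (a δ) (b δ))) - ∫ γ, f γ.curve ∂(SAW.hexSAWLaw D.carrier δ (a' δ) (b' δ))) (𝓝[>] (0 : ℝ)) (𝓝 0) :=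
  fun D a b a' b' hab hab' f _ => hexEndpointMerging_of_latticeUniversality hU D a b a' b' hab hab' f

/-- **(A) → (E*)** as well: under the Duminil-Copin–Smirnov conjecture (`HexSAWScalingLimit`, the content of crux stmt-0808)
the laws along both approximations converge to the law of a chordal SLE(8/3) random curve of `D`; two such curves have
the same law (`IsSLECurve.map_eq_holds`), so the two families merge. Hence (E*) is implied by EACH of stmt-0807 and
stmt-0808 separately — a common no-regret residue of the two cruxes. [folklore] -/
theorem hexEndpointRobust_of_hexConjecture (hA : HexSAWScalingLimit) :
    ∀ (D : DobrushinDomain) (a b a' b' : ℝ → HexVertex), SAW.IsEmbEndpointApprox hexGraph hexCenter D a b → SAW.IsEmbEndpointApprox hexGraph hexCenter D a' b' → ∀ f : BoundedContinuousFunction (CurveClass ℂ) ℝ, LipschitzWith 1 f → Tendsto (fun δ : ℝ => (∫ γ, f γ.curve ∂(SAW.hexSAWLaw D.carrier δ (a δ) (b δ))) - ∫ γ, f γ.curve ∂(SAW.hexSAWLaw D.carrier δ (a' δ) (b' δ))) (𝓝[>] (0 : ℝ)) (𝓝 0) := by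
  intro D a b a' b' hab hab' f _
  obtain ⟨Γ, hΓ, -, hT⟩ := hA D a b hab
  obtain ⟨Γ', hΓ', -, hT'⟩ := hA D a' b' hab'
  have hint : ∫ ω, f (Γ ω) ∂Literature.Probability.Process.preWienerMeasure =
      ∫ ω, f (Γ' ω) ∂Literature.Probability.Process.preWienerMeasure := by
    rw [← integral_map hΓ.1 f.continuous.aestronglyMeasurable,
      ← integral_map hΓ'.1 f.continuous.aestronglyMeasurable, IsSLECurve.map_eq_holds hΓ hΓ']
  have h := (hT f).sub (hT' f)
  rwa [hint, sub_self] at h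

/-! ### The v4.2 composition and the iff -/

/-- **(E*) → (L*) → RobustSquareLimit → AngleUniversality → YBtoUniform → LatticeUniversality** — the composition of
skeleton v4.2 of line `registered`: the kernel VCR assembled from (E*) and (L*) (`hexVertexRobust_of_endpoint_layer`),
then the v4.1 composition `latticeUniversality_of_vcr_robustSquare` (p161241). [folklore] -/
theorem latticeUniversality_of_endpoint_layer
    (hE : ∀ (D : DobrushinDomain) (a b a' b' : ℝ → HexVertex), SAW.IsEmbEndpointApprox hexGraph hexCenter D a b → SAW.IsEmbEndpointApprox hexGraph hexCenter D a' b' → ∀ f : BoundedContinuousFunction (CurveClass ℂ) ℝ, LipschitzWith 1 f → Tendsto (fun δ : ℝ => (∫ γ, f γ.curve ∂(SAW.hexSAWLaw D.carrier δ (a δ) (b δ))) - ∫ γ, f γ.curve ∂(SAW.hexSAWLaw D.carrier δ (a' δ) (b' δ))) (𝓝[>] (0 : ℝ)) (𝓝 0))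
    (hL : ∀ P : ChordalFamily, P.IsChordal → (∀ (D : DobrushinDomain) (u : ℝ → ℂ) (a b : ℝ → MidEdge), (∀ᶠ δ in 𝓝[>] (0 : ℝ), ‖u δ‖ ≤ δ) → (∀ᶠ δ in 𝓝[>] (0 : ℝ), Nonempty (YangBaxterSAW (fun (_ : ℤ) => Real.pi / 3) ((D.map (similarity 1 one_ne_zero (u δ))).carrier) δ (a δ) (b δ))) → Tendsto (fun δ : ℝ => (δ : ℂ) * planeMidpoint (fun (_ : ℤ) => Real.pi / 3) (a δ)) (𝓝[>] (0 : ℝ)) (𝓝 (D.pt 0)) → Tendsto (fun δ : ℝ => (δ : ℂ) * planeMidpoint (fun (_ : ℤ) => Real.pi / 3) (b δ)) (𝓝[>] (0 : ℝ)) (𝓝 (D.pt 1)) → TendstoLaw (fun δ (γ : YangBaxterSAW (fun (_ : ℤ) => Real.pi / 3) ((D.map (similarity 1 one_ne_zero (u δ))).carrier) δ (a δ) (b δ)) => γ.curve (fun (_ : ℤ) => Real.pi / 3) δ) (fun δ => ybLaw (fun (_ : ℤ) => Real.pi / 3) ((D.map (similarity 1 one_ne_zero (u δ))).carrier) δ 1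 (a δ) (b δ)) id (P D)) → ∀ D : DobrushinDomain, ∃ a b : ℝ → HexVertex, SAW.IsEmbEndpointApprox hexGraph hexCenter D a b ∧ TendstoLaw (fun δ (γ : SAW.HexDomainSAW D.carrier δ (a δ) (b δ)) => CurveClass.map (similarity I I_ne_zero 0 : C(ℂ, ℂ)) γ.curve) (fun δ => SAW.hexSAWLaw D.carrier δ (a δ) (b δ)) id (P (D.map (similarity I I_ne_zero 0))))
    (h2 : (∃ P : ChordalFamily, P.IsChordal ∧ ∀ (D : DobrushinDomain) (u : ℝ → ℂ) (a b : ℝ → MidEdge), (∀ᶠ δ in 𝓝[>] (0 : ℝ), ‖u δ‖ ≤ δ) → (∀ᶠ δ in 𝓝[>] (0 : ℝ), Nonempty (YangBaxterSAW (fun (_ : ℤ) => Real.pi / 2) ((D.map (similarity 1 one_ne_zero (u δ))).carrier) δ (a δ) (b δ))) → Tendsto (fun δ : ℝ => (δ : ℂ) * planeMidpoint (fun (_ : ℤ) => Real.pi / 2) (a δ)) (𝓝[>] (0 : ℝ)) (𝓝 (D.pt 0)) → Tendsto (fun δ : ℝ => (δ : ℂ) * planeMidpoint (fun (_ : ℤ)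 => Real.pi / 2) (b δ)) (𝓝[>] (0 : ℝ)) (𝓝 (D.pt 1)) → TendstoLaw (fun δ (γ : YangBaxterSAW (fun (_ : ℤ) => Real.pi / 2) ((D.map (similarity 1 one_ne_zero (u δ))).carrier) δ (a δ) (b δ)) => γ.curve (fun (_ : ℤ) => Real.pi / 2) δ) (fun δ => ybLaw (fun (_ : ℤ) => Real.pi / 2) ((D.map (similarity 1 one_ne_zero (u δ))).carrier) δ 1 (a δ) (b δ)) id (P D)))
    (h3 : SAWTrackTransport.AngleUniversality) (h4 : SAWTrackTransport.YBtoUniform) :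
    SAWMassiveIsingTilt.LatticeUniversality :=
  latticeUniversality_of_vcr_robustSquare (hexVertexRobust_of_endpoint_layer hE hL) h2 h3 h4

/-- **Granted route SAWTrackTransport's three items, the crux is EQUIVALENT to (E*) ∧ (L*)** (→: (E*) from the crux
alone, (L*) through VCR, `hexVertexRobust_of_latticeUniversality` p165464; ←: `latticeUniversality_of_endpoint_layer`).
[folklore] -/
theorem latticeUniversality_iff_endpoint_layer
    (h2 : (∃ P : ChordalFamily, P.IsChordal ∧ ∀ (D : DobrushinDomain) (u : ℝ → ℂ) (a b : ℝ → MidEdge), (∀ᶠ δ in 𝓝[>] (0 : ℝ), ‖u δ‖ ≤ δ) → (∀ᶠ δ in 𝓝[>] (0 : ℝ), Nonempty (YangBaxterSAW (fun (_ : ℤ) => Real.pi / 2) ((D.map (similarity 1 one_ne_zero (u δ))).carrier) δ (a δ) (b δ))) → Tendsto (fun δ : ℝ => (δ : ℂ) * planeMidpoint (fun (_ : ℤ) => Real.pi / 2) (a δ)) (𝓝[>] (0 : ℝ)) (𝓝 (D.pt 0)) → Tendsto (fun δ : ℝ => (δ : ℂ) * planeMidpoint (fun (_ : ℤ) => Real.pi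 / 2) (b δ)) (𝓝[>] (0 : ℝ)) (𝓝 (D.pt 1)) → TendstoLaw (fun δ (γ : YangBaxterSAW (fun (_ : ℤ) => Real.pi / 2) ((D.map (similarity 1 one_ne_zero (u δ))).carrier) δ (a δ) (b δ)) => γ.curve (fun (_ : ℤ) => Real.pi / 2) δ) (fun δ => ybLaw (fun (_ : ℤ) => Real.pi / 2) ((D.map (similarity 1 one_ne_zero (u δ))).carrier) δ 1 (a δ) (b δ)) id (P D)))
    (h3 : SAWTrackTransport.AngleUniversality) (h4 : SAWTrackTransport.YBtoUniform) :
    SAWMassiveIsingTilt.LatticeUniversality ↔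
      ((∀ (D : DobrushinDomain) (a b a' b' : ℝ → HexVertex), SAW.IsEmbEndpointApprox hexGraph hexCenter D a b → SAW.IsEmbEndpointApprox hexGraph hexCenter D a' b' → ∀ f : BoundedContinuousFunction (CurveClass ℂ) ℝ, LipschitzWith 1 f → Tendsto (fun δ : ℝ => (∫ γ, f γ.curve ∂(SAW.hexSAWLaw D.carrier δ (a δ) (b δ))) - ∫ γ, f γ.curve ∂(SAW.hexSAWLaw D.carrier δ (a' δ) (b' δ))) (𝓝[>] (0 : ℝ)) (𝓝 0)) ∧
        (∀ P : ChordalFamily, P.IsChordal → (∀ (D : DobrushinDomain) (u : ℝ → ℂ) (a b : ℝ → MidEdge), (∀ᶠ δ in 𝓝[>] (0 : ℝ), ‖u δ‖ ≤ δ) → (∀ᶠ δ in 𝓝[>] (0 : ℝ), Nonempty (YangBaxterSAW (fun (_ : ℤ) => Real.pi / 3) ((D.map (similarity 1 one_ne_zero (u δ))).carrier) δ (a δ) (b δ))) → Tendsto (fun δ : ℝ => (δ : ℂ) * planeMidpoint (fun (_ : ℤ) => Real.pi / 3) (a δ)) (𝓝[>] (0 : ℝ)) (𝓝 (D.pt 0))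 → Tendsto (fun δ : ℝ => (δ : ℂ) * planeMidpoint (fun (_ : ℤ) => Real.pi / 3) (b δ)) (𝓝[>] (0 : ℝ)) (𝓝 (D.pt 1)) → TendstoLaw (fun δ (γ : YangBaxterSAW (fun (_ : ℤ) => Real.pi / 3) ((D.map (similarity 1 one_ne_zero (u δ))).carrier) δ (a δ) (b δ)) => γ.curve (fun (_ : ℤ) => Real.pi / 3) δ) (fun δ => ybLaw (fun (_ : ℤ) => Real.pi / 3) ((D.map (similarity 1 one_ne_zero (u δ))).carrier) δ 1 (a δ) (b δ)) id (P D)) → ∀ D : DobrushinDomain, ∃ a b : ℝ → HexVertex, SAW.IsEmbEndpointApprox hexGraph hexCenter D a b ∧ TendstoLaw (fun δ (γ : SAW.HexDomainSAW D.carrier δ (a δ) (b δ)) => CurveClass.map (similarity I I_ne_zero 0 : C(ℂ, ℂ)) γ.curve) (fun δ => SAW.hexSAWLaw D.carrier δ (a δ) (b δ)) id (P (D.map (similarity I I_ne_zero 0))))) :=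
  ⟨fun hU => ⟨hexEndpointRobust_of_latticeUniversality hU,
      hexLayerRobust_of_hexVertexRobust (hexVertexRobust_of_latticeUniversality hU h2 h3 h4)⟩,
    fun h => latticeUniversality_of_endpoint_layer h.1 h.2 h2 h3 h4⟩

/-! ### Registered sub-goal (arrow form, for `--supports stmt-CriticalPhenomena-0807`) -/

/-- **Registered sub-goal** `latticeUniversality_of_endpointLayerRobustSquare`: (E*) → (L*) → (conjunct (ii) of
`YBLimitExists`) → AngleUniversality → YBtoUniform → LatticeUniversality — the composition of skeleton v4.2 of line
`registered`. [folklore] -/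
theorem latticeUniversality_of_endpointLayerRobustSquare : (∀ (D : DobrushinDomain) (a b a' b' : ℝ → HexVertex), SAW.IsEmbEndpointApprox hexGraph hexCenter D a b → SAW.IsEmbEndpointApprox hexGraph hexCenter D a' b' → ∀ f : BoundedContinuousFunction (CurveClass ℂ) ℝ, LipschitzWith 1 f → Tendsto (fun δ : ℝ => (∫ γ, f γ.curve ∂(SAW.hexSAWLaw D.carrier δ (a δ) (b δ))) - ∫ γ, f γ.curve ∂(SAW.hexSAWLaw D.carrier δ (a' δ) (b' δ))) (𝓝[>] (0 : ℝ)) (𝓝 0)) → (∀ P : ChordalFamily, P.IsChordal → (∀ (D : DobrushinDomain) (u : ℝ → ℂ) (a b : ℝ → MidEdge), (∀ᶠ δ in 𝓝[>] (0 : ℝ), ‖u δ‖ ≤ δ) → (∀ᶠ δ in 𝓝[>] (0 : ℝ), Nonempty (YangBaxterSAW (fun (_ : ℤ) => Real.pi / 3) ((D.map (similarity 1 one_ne_zero (u δ))).carrier) δ (a δ) (b δ))) → Tendsto (fun δ : ℝ => (δ : ℂ) * planeMidpoint (fun (_ : ℤ) => Real.pi / 3) (a δ)) (𝓝[>] (0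 : ℝ)) (𝓝 (D.pt 0)) → Tendsto (fun δ : ℝ => (δ : ℂ) * planeMidpoint (fun (_ : ℤ) => Real.pi / 3) (b δ)) (𝓝[>] (0 : ℝ)) (𝓝 (D.pt 1)) → TendstoLaw (fun δ (γ : YangBaxterSAW (fun (_ : ℤ) => Real.pi / 3) ((D.map (similarity 1 one_ne_zero (u δ))).carrier) δ (a δ) (b δ)) => γ.curve (fun (_ : ℤ) => Real.pi / 3) δ) (fun δ => ybLaw (fun (_ : ℤ) => Real.pi / 3) ((D.map (similarity 1 one_ne_zero (u δ))).carrier) δ 1 (a δ) (b δ)) id (P D)) → ∀ D : DobrushinDomain, ∃ a b : ℝ → HexVertex, SAW.IsEmbEndpointApprox hexGraph hexCenter D a b ∧ TendstoLaw (fun δ (γ : SAW.HexDomainSAW D.carrier δ (a δ) (b δ)) => CurveClass.map (similarity I I_ne_zero 0 : C(ℂ, ℂ)) γ.curve) (fun δ => SAW.hexSAWLaw D.carrier δ (a δ) (b δ)) id (P (D.map (similarity I I_ne_zero 0)))) → (∃ P : ChordalFamily, P.IsChordal ∧ ∀ (D : DobrushinDomain) (u : ℝ → ℂ) (a b : ℝ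 → MidEdge), (∀ᶠ δ in 𝓝[>] (0 : ℝ), ‖u δ‖ ≤ δ) → (∀ᶠ δ in 𝓝[>] (0 : ℝ), Nonempty (YangBaxterSAW (fun (_ : ℤ) => Real.pi / 2) ((D.map (similarity 1 one_ne_zero (u δ))).carrier) δ (a δ) (b δ))) → Tendsto (fun δ : ℝ => (δ : ℂ) * planeMidpoint (fun (_ : ℤ) => Real.pi / 2) (a δ)) (𝓝[>] (0 : ℝ)) (𝓝 (D.pt 0)) → Tendsto (fun δ : ℝ => (δ : ℂ) * planeMidpoint (fun (_ : ℤ) => Real.pi / 2) (b δ)) (𝓝[>] (0 : ℝ)) (𝓝 (D.pt 1)) → TendstoLaw (fun δ (γ : YangBaxterSAW (fun (_ : ℤ) => Real.pi / 2) ((D.map (similarity 1 one_ne_zero (u δ))).carrier) δ (a δ) (b δ)) => γ.curve (fun (_ : ℤ) => Real.pi / 2) δ) (fun δ => ybLaw (fun (_ : ℤ) => Real.pi / 2) ((D.map (similarity 1 one_ne_zero (u δ))).carrier) δ 1 (a δ) (b δ)) id (P D)) → SAWTrackTransport.AngleUniversality → SAWTrackTransport.YBtoUniform → SAWMassiveIsingTilt.LatticeUniversality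 :=
  fun hE hL h2 h3 h4 => latticeUniversality_of_endpoint_layer hE hL h2 h3 h4

end Summit.CriticalPhenomena.SAWScalingLimit.Cruxes.LatticeUniversality.Birth

end
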